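import Literature.NumberTheory.EllipticCurves.Kato2004.IwasawaH1ProjZeroKernelProofs
import Literature.NumberTheory.EllipticCurves.Kato2004.IwasawaH1LambdaTorsionFreeProofs
import Literature.NumberTheory.EllipticCurves.Kato2004.DescentCokernelFiniteOfRankLeOneProofs
import Literature.NumberTheory.EllipticCurves.IwasawaAlgebraRankLeOneOfCoinvariantsProofs
import HarnessLib

/-!
# Kato 2004 (Astérisque 295), Thm. 12.4 (2) on the pin, UPPER HALF: `rank_Λ 𝐇¹_Γ(T_pW) ≤ 1` whenever
# `rank_{ℤ_p} H¹(ℤ[1/p], T_pW) ≤ 1` — and what is then left of `thm12_4` is `𝐇¹_Γ(T_pW) ≠ 0` (proofs only)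

Topic `NumberTheory/EllipticCurves`, sub-directory `Kato2004` (namespace = path).  Cell `bsd-cn100`, prover
seat `bsd-cn100-s2-c3` (g12).  Companion of `IwasawaCohomology.lean` (the named fact `Kato2004.thm12_4`:
(12.2.1) `𝐇¹_Γ` finitely generated ∧ Thm. 12.4 (2) torsion free of `Λ`-rank `1` ∧ Thm. 12.4 (3)), of
`IwasawaH1ProjZeroKernelProofs.lean` (bsd-potss-rkm g8: (α) = (14.14.1) injectivity
`proj₀ x = 0 → x ∈ T·𝐇¹_Γ` and (12.2.1) `module_finite_of_isCyclotomic`, THEOREMS), of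
`IwasawaH1LambdaTorsionFreeProofs.lean` (bsd-potss-rkm g7: `𝐇¹_Γ` is `Λ`-torsion free, THEOREM) and of
`DescentCokernelFiniteOfRankLeOneProofs.lean` (this seat, g11).

## What is proved (no definition, no named fact; everything a theorem)

Write `A := H¹(ℤ[1/p], T_pW)` (`integralH1 (tateRep W p) p (κ.layerSubgroup 0)`), `𝐇¹ := I.H` for a pin
`I : IwasawaH1Data W p κ γ` (`κ` the cyclotomic `ℤ_p`-extension, `γ` a topological generator).

* `IwasawaH1Data.rank_le_one_of_rank_integralH1_le_one` — **(R2), PIN LEVEL: `rank_{ℤ_p} A ≤ 1 ⟹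
  rank_Λ 𝐇¹ ≤ 1`**, for EVERY `W/ℚ` and EVERY prime `p`.  Proof: `𝐇¹` is finitely generated
  (`module_finite_of_isCyclotomic`) and torsion free (`isTorsionFree`); for `u, v ∈ 𝐇¹` the classes
  `proj₀ u, proj₀ v ∈ A` are `ℤ_p`-dependent (`rank A ≤ 1`), say `a·proj₀ u + b·proj₀ v = 0` with
  `(a, b) ≠ 0`, so `proj₀ (a u + b v) = 0` (`proj_C_smul`) and `a u + b v ∈ T·𝐇¹` by (α)
  (`TwistTate.mem_TSubmodule_of_proj_zero_eq_zero`); the module algebra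
  `IwasawaAlgebra.rank_le_one_of_forall_exists_C_smul_add_C_smul_eq_X_smul` concludes.
* `IwasawaH1Data.rank_eq_one_of_rank_integralH1_le_one` — with `𝐇¹ ≠ 0` in addition, `rank_Λ 𝐇¹ = 1`.
* `IwasawaH1Data.thm12_4_clauses_of_nontrivial_of_rank_integralH1_le_one` — under `𝐇¹ ≠ 0` and
  `rank_{ℤ_p} A ≤ 1`, the first two clauses of `thm12_4` AT THIS PIN hold outright:
  `Module.Finite Λ 𝐇¹ ∧ (Module.IsTorsionFree Λ 𝐇¹ ∧ Module.rank Λ 𝐇¹ = 1)` (the shape destructured by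
  the consumers `readingRK_of_facts`, `finite_descentCokernel_of_rankOne_of_rank_le_one`).
* `nontrivial_iwasawaH1_of_thm12_4` — the named fact `thm12_4` implies the DISPLAYED statement
  (NT) `∀ W p κ γ I, Nontrivial I.H` («`𝐇¹_Γ(T_pW) ≠ 0`», the LOWER half of Thm. 12.4 (2): Kato proves it
  from the non-vanishing of his Euler system, Thm. 12.5 with Rohrlich's theorem, §13).
* `finite_descentCokernel_of_rankOne_of_nontrivial_of_rank_le_one` — FACT LEVEL: the named fact
  `finite_descentCokernel_of_rankOne` from (NT) and the displayed base-level bound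
  (R1) `rank_ℤ W(ℚ) = 1 → #Ш(W)[p^∞] < ∞ → rank_{ℤ_p} A ≤ 1` ALONE ((α), (12.2.1) and torsion-freeness
  being tree theorems now) — g11's `finite_descentCokernel_of_rankOne_of_rank_le_one` with its
  `thm12_4` hypothesis replaced by (NT).

## Why (calibration for the registered lines `kato-zeta-perrin-riou` on stmt-BirchSwinnertonDyer-19080 / -19160)

After the v1g re-cut the citation-borne stub is RI7 = six refereed theorems ∧ `thm12_4`.  Of `thm12_4`
the consumers use (12.2.1), torsion-freeness and `rank = 1` (clause (3) is never used).  With this file,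
UNDER THE CRUX HYPOTHESES (rank one, `Ш[p^∞]` finite — where (R1) is the Summits-side theorem
`CongruentShaFreeCutIntegralH1RankLeOne.rank_integralH1_layerZero_le_one`, p508547), everything in
`thm12_4` that the road consumes is a tree theorem EXCEPT the single bit (NT) «`𝐇¹_Γ(T_pW) ≠ 0`», i.e.
the existence of ONE non-zero norm-compatible family of integral classes up the cyclotomic tower — the
place where Kato's zeta elements (or any Euler system) must enter.  The Summits-side census
`Theorems/CongruentShaFreeCutKatoZetaRoadNontrivialH1.lean` records the crux modulo RI6 ∧ (NT) ∧ PR₂.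
HONEST FRAMING: (NT) is NOT proved here; nothing about Kato's Main Conjecture, the Perrin-Riou formula,
crux B, the leaf or BSD.  No `instance`, no notation.

## References

* K. Kato, *p-adic Hodge theory and values of zeta functions of modular forms*, Astérisque 295 (2004):
  §12.2 (12.2.1) (p. 220), Thm. 12.4 (2) (p. 221), Thm. 12.5 and §13 (non-vanishing of the Euler system),
  §14.14 (14.14.1) (p. 243). [Kato2004Asterisque]
* J. Coates, R. Sujatha, *Cyclotomic Fields and Zeta Values* (2006), Appendix Thm. 1 (the hull statement
  behind the module algebra). [CoatesSujatha2006Cyclotomic]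
* Tree: `Kato2004/IwasawaCohomology.lean` (`IwasawaH1Data`, `thm12_4`), `Kato2004/IwasawaH1ProjZeroKernelProofs.lean`
  ((α), `module_finite_of_isCyclotomic`), `Kato2004/IwasawaH1LambdaTorsionFreeProofs.lean` (`isTorsionFree`,
  `noZeroSMulDivisors`), `Kato2004/DescentCokernelFiniteOfRankLeOneProofs.lean`
  (`finite_descentCokernel_of_rank_le_one`), `IwasawaAlgebraRankLeOneOfCoinvariantsProofs.lean` (this seat, g12).
-/

noncomputable section

open Field
open Literature.NumberTheory.GaloisRepresentations
open Literature.NumberTheory.EllipticCurves Literature.NumberTheory.EllipticCurves.Kato2004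
open Literature.NumberTheory.EllipticCurves.Kato2004.EulerSystemValues
open Literature.NumberTheory.EllipticCurves.IwasawaAlgebra

namespace Literature.NumberTheory.EllipticCurves.Kato2004

/-! ## §1 Pin level: (R2) `rank_{ℤ_p} H¹(ℤ[1/p], T_pW) ≤ 1 ⟹ rank_Λ 𝐇¹_Γ(T_pW) ≤ 1` -/

namespace IwasawaH1Data

variable {W : WeierstrassCurve ℚ} [W.IsElliptic] {p : ℕ} [Fact p.Prime]
  [ContinuousSMul ℤ_[p] (W.tateModule p)] {κ : ZpExtension ℚ p} {γ : absoluteGaloisGroup ℚ}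

/-- **(R2) — Kato Thm. 12.4 (2), upper half, on the pin: `rank_{ℤ_p} H¹(ℤ[1/p], T_pW) ≤ 1` implies
`rank_Λ 𝐇¹_Γ(T_pW) ≤ 1`**, for every elliptic `W/ℚ`, every prime `p`, the cyclotomic `κ` and any
topological generator `γ`.  Ingredients, all tree theorems: (12.2.1) `module_finite_of_isCyclotomic`,
torsion-freeness `isTorsionFree`, (14.14.1)-injectivity `TwistTate.mem_TSubmodule_of_proj_zero_eq_zero`
(so that a `ℤ_p`-relation between `proj₀ u`, `proj₀ v` lifts to `a u + b v ∈ T·𝐇¹`), and the module algebra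
`IwasawaAlgebra.rank_le_one_of_forall_exists_C_smul_add_C_smul_eq_X_smul`.
[cite: Kato2004Asterisque, Thm. 12.4 (2) (p. 221), §12.2 (12.2.1) (p. 220) and §14.14 (14.14.1) (p. 243)] -/
theorem rank_le_one_of_rank_integralH1_le_one (hκ : κ.IsCyclotomic) (hγ : κ.IsTopGenerator γ)
    (I : IwasawaH1Data W p κ γ)
    (hrank : Module.rank ℤ_[p] (integralH1 (tateRep W p) p (κ.layerSubgroup 0)) ≤ 1) :
    Module.rank (IwasawaAlgebra p) I.H ≤ 1 := by
  haveI := IwasawaH1Data.module_finite_of_isCyclotomic hκ hγ I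
  haveI := I.isTorsionFree hγ
  apply IwasawaAlgebra.rank_le_one_of_forall_exists_C_smul_add_C_smul_eq_X_smul
  intro u v
  set A := integralH1 (tateRep W p) p (κ.layerSubgroup 0) with hA_def
  let α : A := ⟨I.proj 0 u, I.proj_mem 0 u⟩
  let β : A := ⟨I.proj 0 v, I.proj_mem 0 v⟩
  -- `α`, `β` are `ℤ_p`-linearly dependent in `A` (`rank A ≤ 1`)
  have hdep : ∃ a b : ℤ_[p], (a ≠ 0 ∨ b ≠ 0) ∧ a • α + b • β = 0 := by
    by_contra hcon
    push Not at hcon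
    have hli : LinearIndependent ℤ_[p] ![α, β] := by
      rw [LinearIndependent.pair_iff]
      intro s t hst
      by_contra hne
      exact hcon s t (not_and_or.mp hne) hst
    have h2 : (2 : Cardinal) ≤ Module.rank ℤ_[p] A := by
      simpa using hli.cardinal_lift_le_rank
    have h21 : (2 : Cardinal) ≤ 1 := h2.trans hrank
    norm_num at h21
  obtain ⟨a, b, hab, h0⟩ := hdep
  refine ⟨a, b, hab, ?_⟩
  have hproj : I.proj 0 ((PowerSeries.C a : IwasawaAlgebra p) • u +
      (PowerSeries.C b : IwasawaAlgebra p) • v) = 0 := by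
    rw [map_add, I.proj_C_smul, I.proj_C_smul]
    have h0' := congrArg Subtype.val h0
    simpa [α, β] using h0'
  obtain ⟨m, hm⟩ := (mem_TSubmodule_iff p I.H _).mp
    (TwistTate.mem_TSubmodule_of_proj_zero_eq_zero W p κ hκ hγ I _ hproj)
  exact ⟨m, hm.symm⟩

/-- **`rank_Λ 𝐇¹_Γ(T_pW) = 1`** on the pin, from `rank_{ℤ_p} H¹(ℤ[1/p], T_pW) ≤ 1` AND `𝐇¹_Γ(T_pW) ≠ 0`
(`Nontrivial I.H`): the upper bound is (R2), the lower bound is `rank_pos` for the torsion-free non-zero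
`Λ`-module `𝐇¹`. [cite: Kato2004Asterisque, Thm. 12.4 (2) (p. 221)] -/
theorem rank_eq_one_of_rank_integralH1_le_one (hκ : κ.IsCyclotomic) (hγ : κ.IsTopGenerator γ)
    (I : IwasawaH1Data W p κ γ) [Nontrivial I.H]
    (hrank : Module.rank ℤ_[p] (integralH1 (tateRep W p) p (κ.layerSubgroup 0)) ≤ 1) :
    Module.rank (IwasawaAlgebra p) I.H = 1 := by
  haveI := I.isTorsionFree hγ
  refine le_antisymm (I.rank_le_one_of_rank_integralH1_le_one hκ hγ hrank) ?_
  exact Cardinal.one_le_iff_pos.mpr rank_pos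

/-- **The consumed clauses of `thm12_4` AT A PIN, outright from `𝐇¹ ≠ 0` and `rank_{ℤ_p} H¹(ℤ[1/p], T_pW) ≤ 1`:**
`Module.Finite Λ 𝐇¹ ∧ (Module.IsTorsionFree Λ 𝐇¹ ∧ Module.rank Λ 𝐇¹ = 1)` — (12.2.1) and Thm. 12.4 (2) in
the shape destructured by `readingRK_of_facts` / `finite_descentCokernel_of_rankOne_of_rank_le_one`
(`obtain ⟨hfin, ⟨htf, hrk⟩, -⟩ := h12 W p κ γ hκ hγ I`). [cite: Kato2004Asterisque, §12.2 (12.2.1) (p. 220) and Thm. 12.4 (2) (p. 221)] -/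
theorem thm12_4_clauses_of_nontrivial_of_rank_integralH1_le_one (hκ : κ.IsCyclotomic)
    (hγ : κ.IsTopGenerator γ) (I : IwasawaH1Data W p κ γ) [Nontrivial I.H]
    (hrank : Module.rank ℤ_[p] (integralH1 (tateRep W p) p (κ.layerSubgroup 0)) ≤ 1) :
    Module.Finite (IwasawaAlgebra p) I.H ∧
      (Module.IsTorsionFree (IwasawaAlgebra p) I.H ∧ Module.rank (IwasawaAlgebra p) I.H = 1) :=
  ⟨IwasawaH1Data.module_finite_of_isCyclotomic hκ hγ I, I.isTorsionFree hγ,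
    I.rank_eq_one_of_rank_integralH1_le_one hκ hγ hrank⟩

end IwasawaH1Data

/-! ## §2 Fact level: what is left of `thm12_4` on the road is «`𝐇¹_Γ(T_pW) ≠ 0`» -/

/-- **`thm12_4` implies (NT) «`𝐇¹_Γ(T_pW) ≠ 0` on every pin»** (`Module.rank Λ 𝐇¹ = 1 ≠ 0`).  (NT) is the
LOWER half of Kato Thm. 12.4 (2) — proved by Kato from the non-vanishing of the Euler system of zeta
elements (Thm. 12.5, Rohrlich) — and is the only part of `thm12_4` the descent road still consumes as an
input (the rest being tree theorems under (R1)); displayed here, NOT proved.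
[cite: Kato2004Asterisque, Thm. 12.4 (2) (p. 221) and Thm. 12.5 (p. 222)] -/
theorem nontrivial_iwasawaH1_of_thm12_4 (h12 : thm12_4) :
    ∀ (W : WeierstrassCurve ℚ) [W.IsElliptic] (p : ℕ) [Fact p.Prime]
      [ContinuousSMul ℤ_[p] (W.tateModule p)] (κ : ZpExtension ℚ p) (γ : absoluteGaloisGroup ℚ),
      κ.IsCyclotomic → κ.IsTopGenerator γ → ∀ I : IwasawaH1Data W p κ γ, Nontrivial I.H := by
  intro W _ p _ _ κ γ hκ hγ I
  obtain ⟨-, ⟨-, hrk⟩, -⟩ := h12 W p κ γ hκ hγ I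
  by_contra hnt
  rw [not_nontrivial_iff_subsingleton] at hnt
  have h0 : Module.rank (IwasawaAlgebra p) I.H = 0 := rank_subsingleton' _ _
  rw [hrk] at h0
  exact one_ne_zero h0

/-- **The named fact `finite_descentCokernel_of_rankOne` from (NT) «`𝐇¹_Γ ≠ 0`» and the displayed base-level
bound (R1) ALONE** — g11's `finite_descentCokernel_of_rankOne_of_rank_le_one` with `nonempty_iwasawaH2Data`
DISCHARGED (`nonempty_iwasawaH2Data_holds`, bsd-potss-rkm g8) and `thm12_4` REPLACED by (NT): (12.2.1) is
`module_finite_of_isCyclotomic`, torsion-freeness is `isTorsionFree`, and `rank = 1` is not needed beyond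
`𝐇¹ ≠ 0` (`finite_descentCokernel_of_rank_le_one` only uses `Nontrivial I.H`).
[cite: Kato2004Asterisque, §14.14 (14.14.1) (p. 243), Thm. 12.4 (2) (p. 221), §14.9 (14.9.3) (p. 240)] -/
theorem finite_descentCokernel_of_rankOne_of_nontrivial_of_rank_le_one
    (hNT : ∀ (W : WeierstrassCurve ℚ) [W.IsElliptic] (p : ℕ) [Fact p.Prime]
      [ContinuousSMul ℤ_[p] (W.tateModule p)] (κ : ZpExtension ℚ p) (γ : absoluteGaloisGroup ℚ),
      κ.IsCyclotomic → κ.IsTopGenerator γ → ∀ I : IwasawaH1Data W p κ γ, Nontrivial I.H)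
    (hR1 : ∀ (W : WeierstrassCurve ℚ) [W.IsElliptic] (p : ℕ) [Fact p.Prime]
      [ContinuousSMul ℤ_[p] (W.tateModule p)] (κ : ZpExtension ℚ p),
      W.mordellWeilRank = 1 → Finite (AddCommGroup.primaryComponent W.sha p) →
        Module.rank ℤ_[p] (integralH1 (tateRep W p) p (κ.layerSubgroup 0)) ≤ 1) :
    finite_descentCokernel_of_rankOne := by
  intro W _ p _ _ κ γ hκ hγ I hrank hsha
  haveI := IwasawaH1Data.module_finite_of_isCyclotomic hκ hγ I
  haveI := I.isTorsionFree hγ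
  haveI : Nontrivial I.H := hNT W p κ γ hκ hγ I
  exact I.finite_descentCokernel_of_rank_le_one
    (fun x hx ↦ TwistTate.mem_TSubmodule_of_proj_zero_eq_zero W p κ hκ hγ I x hx) (hR1 W p κ hrank hsha)

/-- The same with (NT) asked only where the road needs it — at pins of curves of rank one with finite
`Ш[p^∞]` (the crux hypotheses): `finite_descentCokernel_of_rankOne` from the CRUX-LOCAL non-vanishing
«rank_ℤ W(ℚ) = 1 → #Ш(W)[p^∞] < ∞ → 𝐇¹_Γ(T_pW) ≠ 0» and (R1).
[cite: Kato2004Asterisque, §14.14 (14.14.1) (p. 243) and Thm. 12.4 (2) (p. 221)] -/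
theorem finite_descentCokernel_of_rankOne_of_nontrivial_of_rankOne_of_rank_le_one
    (hNT : ∀ (W : WeierstrassCurve ℚ) [W.IsElliptic] (p : ℕ) [Fact p.Prime]
      [ContinuousSMul ℤ_[p] (W.tateModule p)] (κ : ZpExtension ℚ p) (γ : absoluteGaloisGroup ℚ),
      κ.IsCyclotomic → κ.IsTopGenerator γ → ∀ I : IwasawaH1Data W p κ γ,
        W.mordellWeilRank = 1 → Finite (AddCommGroup.primaryComponent W.sha p) → Nontrivial I.H)
    (hR1 : ∀ (W : WeierstrassCurve ℚ) [W.IsElliptic] (p : ℕ) [Fact p.Prime]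
      [ContinuousSMul ℤ_[p] (W.tateModule p)] (κ : ZpExtension ℚ p),
      W.mordellWeilRank = 1 → Finite (AddCommGroup.primaryComponent W.sha p) →
        Module.rank ℤ_[p] (integralH1 (tateRep W p) p (κ.layerSubgroup 0)) ≤ 1) :
    finite_descentCokernel_of_rankOne := by
  intro W _ p _ _ κ γ hκ hγ I hrank hsha
  haveI := IwasawaH1Data.module_finite_of_isCyclotomic hκ hγ I
  haveI := I.isTorsionFree hγ
  haveI : Nontrivial I.H := hNT W p κ γ hκ hγ I hrank hsha
  exact I.finite_descentCokernel_of_rank_le_one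
    (fun x hx ↦ TwistTate.mem_TSubmodule_of_proj_zero_eq_zero W p κ hκ hγ I x hx) (hR1 W p κ hrank hsha)

end Literature.NumberTheory.EllipticCurves.Kato2004

end
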